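import Summits.Ventures.HodgeRepro2.T5SexticRecordSatake

/-!
# SUMMARY THEOREM FOR THE BRIEF'S «SEXTIC GALOIS CM CASE»: one statement per field — cyclic Galois group, cyclic
# cubic `K⁺`, the inert/split census by the parity of `f(P/p)`, and the Satake chain with `q = p^{f(v/p)}` at the
# inert places

Tier-5 support N2 / N3 / §G-N4.2 (seat p3, gen 80). Files 280–282 are gathered into two statements that a reader of
TIER4.md §B1 / TIER5.md §N3 can cite by one name each. Nothing new is proved; every conjunct is a theorem of files
280–282 (and through them of files 49 / 63 / 66 / 97 / 125 / 251 / 264 / 279):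

* **`sextic_galois_cm_structure`** — for every CM field `K` Galois over `ℚ` with `[K : ℚ] = 6`: `Gal(K/ℚ)` is
  cyclic, `K⁺/ℚ` is Galois with cyclic group and `[K⁺ : ℚ] = 3`, and `f(v/p) ∈ {1, 3}` for every place `v` of `K⁺`
  above a rational prime `p`;
* **`sextic_galois_cm_census_and_satake`** — for every such `K`, every rational prime `p`, every prime `P` of `K`
  above `p` lying over the place `v` of `K⁺`, with `p` unramified in `K`: `v` stays prime in `K` iff `f(P/p)` is
  even iff `f(P/p) ∈ {2, 6}`, two primes above `v` iff `f(P/p)` is odd, and in the inert case `f(P/p) = 2 f(v/p)`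
  and the cells / degrees / tree recursion of the record's pair hold with `q = p^{f(v/p)}` for every hermitian `H`
  with unit determinant good above `v`, every generator family and every field of characteristic `0`.

§8(d): uses an L-value-free non-vanishing device: NO.
-/

open Matrix NumberField NumberField.IsCMField IsDedekindDomain IsDedekindDomain.HeightOneSpectrum Module Polynomial
  MulAction
open scoped TensorProduct Pointwise
open Summit.Ventures.HodgeRepro2.T5UnitaryGroupForm Summit.Ventures.HodgeRepro2.T5UnitaryHeckeAdjoint
  Summit.Ventures.HodgeRepro2.T5HeckePermutationModule Summit.Ventures.HodgeRepro2.T5HeckeDoubleCoset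
  Summit.Ventures.HodgeRepro2.T5RecordHyperspecial Summit.Ventures.HodgeRepro2.T5GlobalLatticeAlmostAll
  Summit.Ventures.HodgeRepro2.T5FinitePlaceSplitClassification Summit.Ventures.HodgeRepro2.T5RecordSatakeIntrinsic
  Summit.Ventures.HodgeRepro2.T5CMFieldSquareDatum Summit.Ventures.HodgeRepro2.T5RecordSatakeToy
  Summit.Ventures.HodgeRepro2.T5SplitPlaceUnitaryGroup Summit.Ventures.HodgeRepro2.T5NonSplitPlaceUnitaryGroup
  Summit.Ventures.HodgeRepro2.T5FinitePlaceCM Summit.Ventures.HodgeRepro2.T5StarOfInvolution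
  Summit.Ventures.HodgeRepro2.T5RecordSatake Summit.Ventures.HodgeRepro2.T5RecordSatakeInert
  Summit.Ventures.HodgeRepro2.T5RecordSatakeInertToyDegree Summit.Ventures.HodgeRepro2.T5RecordSatakeDegreeCells
  Summit.Ventures.HodgeRepro2.T5CyclotomicSevenHeckeCommutative
  Summit.Ventures.HodgeRepro2.T5CMFieldConjugationCentral Summit.Ventures.HodgeRepro2.T5CMFieldCyclicGaloisCriterion
  Summit.Ventures.HodgeRepro2.T5SexticRecordSatake

namespace Summit.Ventures.HodgeRepro2.T5SexticGaloisCMSummary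

variable (K : Type*) [Field K] [NumberField K] [IsCMField K] [IsGalois ℚ K] (h6 : Module.finrank ℚ K = 6)
include h6

/-- **THE STRUCTURE OF A SEXTIC GALOIS CM FIELD** (files 280–281): `Gal(K/ℚ)` cyclic; `K⁺/ℚ` Galois, cyclic, of
degree `3`; `f(v/p) ∈ {1, 3}` for every place `v` of `K⁺` above every rational prime `p`. -/
theorem sextic_galois_cm_structure :
    IsCyclic (K ≃ₐ[ℚ] K) ∧ IsGalois ℚ (maximalRealSubfield K) ∧
      IsCyclic (maximalRealSubfield K ≃ₐ[ℚ] maximalRealSubfield K) ∧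
      Module.finrank ℚ (maximalRealSubfield K) = 3 ∧
      ∀ (p : ℕ) [Fact p.Prime] (v : HeightOneSpectrum (𝓞 (maximalRealSubfield K)))
        [v.asIdeal.LiesOver (Ideal.span {(p : ℤ)})],
        v.asIdeal.inertiaDeg ℤ = 1 ∨ v.asIdeal.inertiaDeg ℤ = 3 :=
  ⟨T5CMFieldCyclicGaloisCriterion.isCyclic_gal K h6,
    T5CMFieldCyclicGaloisCriterion.isGalois_maximalRealSubfield K h6,
    T5CMFieldCyclicGaloisCriterion.isCyclic_gal_maximalRealSubfield K h6,
    T5CMFieldCyclicGaloisCriterion.finrank_maximalRealSubfield K h6,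
    fun p _ v _ => T5CMFieldCyclicGaloisCriterion.inertiaDeg_under_eq_one_or_three K h6 p v⟩

variable (p : ℕ) [hp : Fact p.Prime]
variable (P : Ideal (𝓞 K)) [hP : P.IsPrime] [hPp : P.LiesOver (Ideal.span {(p : ℤ)})]
variable (v : HeightOneSpectrum (𝓞 (maximalRealSubfield K))) [hPv : P.LiesOver v.asIdeal]

include p hp hPp in
/-- **THE CENSUS AND THE SATAKE CHAIN OF THE SEXTIC GALOIS CM CASE** (files 281–282): for `p` unramified in `K`,
`v` stays prime in `K` iff `f(P/p)` is even iff `f(P/p) ∈ {2, 6}`; two primes above `v` iff `f(P/p)` is odd; and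
when `f(P/p)` is even, `f(P/p) = 2 f(v/p)` and the record's pair `(U(1 ⊗ H), K_v)` carries the cells `gₙ` with
`deg Tₙ = (q³ + 1) q^{4n−3}`, `deg T₀ = 1`, `T₁ T_{n+2} = T_{n+3} + (q − 1) T_{n+2} + q⁴ T_{n+1}` and
`T₁² = T₂ + (q − 1) T₁ + (q⁴ + q) T₀` with `q = p^{f(v/p)}`, for every hermitian `H` with unit determinant good above
`v`, every generator family `l` and every field `k` of characteristic `0`. -/
theorem sextic_galois_cm_census_and_satake (he : P.ramificationIdx ℤ = 1) :
    ((∃ w : HeightOneSpectrum (𝓞 K),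
        Ideal.map (algebraMap (𝓞 (maximalRealSubfield K)) (𝓞 K)) v.asIdeal = w.asIdeal) ↔
      Even (P.inertiaDeg ℤ)) ∧
    ((v.asIdeal.primesOver (𝓞 K)).ncard = 1 ↔ P.inertiaDeg ℤ = 2 ∨ P.inertiaDeg ℤ = 6) ∧
    ((v.asIdeal.primesOver (𝓞 K)).ncard = 2 ↔ Odd (P.inertiaDeg ℤ)) ∧
    (Even (P.inertiaDeg ℤ) →
      ∀ {r : ℕ} (l : Fin r → 𝓞 K) (k : Type*) [Field k] [CharZero k],
        Submodule.span (𝓞 (maximalRealSubfield K)) (Set.range l) = ⊤ →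
        ∀ {H : Matrix (Fin 3) (Fin 3) K}, H.IsHermitian → IsUnit H.det →
        (∀ w : HeightOneSpectrum (𝓞 K), w.asIdeal.LiesOver v.asIdeal → w ∉ badSet H) →
        (v.asIdeal.inertiaDeg ℤ = 1 ∨ v.asIdeal.inertiaDeg ℤ = 3) ∧ P.inertiaDeg ℤ = 2 * v.asIdeal.inertiaDeg ℤ ∧
        ∃ g : ℕ → (letI := tensorStarRing K v; ↥(formUnitaryGroup (tensorGram K v H))),
          (∀ n, 1 ≤ n → (orbit (recordHyperspecial K v l H)
            (g n : _ ⧸ recordHyperspecial K v l H)).ncard =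
              ((p ^ v.asIdeal.inertiaDeg ℤ) ^ 3 + 1) * (p ^ v.asIdeal.inertiaDeg ℤ) ^ (4 * n - 3)) ∧
          (orbit (recordHyperspecial K v l H) (g 0 : _ ⧸ recordHyperspecial K v l H)).ncard = 1 ∧
          ∃ hfin : ∀ n, Finite (orbit (recordHyperspecial K v l H) (g n : _ ⧸ recordHyperspecial K v l H)),
            (∀ n, letI := hfin 1; letI := hfin (n + 1 + 1); letI := hfin (n + 1 + 1 + 1); letI := hfin (n + 1);
              doubleCosetOp k (recordHyperspecial K v l H) (g 1) *
                  doubleCosetOp k (recordHyperspecial K v l H) (g (n + 1 + 1)) =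
                doubleCosetOp k (recordHyperspecial K v l H) (g (n + 1 + 1 + 1)) +
                  ((p : k) ^ v.asIdeal.inertiaDeg ℤ - 1) •
                    doubleCosetOp k (recordHyperspecial K v l H) (g (n + 1 + 1)) +
                  ((p : k) ^ v.asIdeal.inertiaDeg ℤ) ^ 4 •
                    doubleCosetOp k (recordHyperspecial K v l H) (g (n + 1))) ∧
            (letI := hfin 1; letI := hfin (0 + 1); letI := hfin (0 + 1 + 1); letI := hfin 0;
              doubleCosetOp k (recordHyperspecial K v l H) (g 1) *
                  doubleCosetOp k (recordHyperspecial K v l H) (g (0 + 1)) =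
                doubleCosetOp k (recordHyperspecial K v l H) (g (0 + 1 + 1)) +
                  ((p : k) ^ v.asIdeal.inertiaDeg ℤ - 1) •
                    doubleCosetOp k (recordHyperspecial K v l H) (g (0 + 1)) +
                  (((p : k) ^ v.asIdeal.inertiaDeg ℤ) ^ 4 + (p : k) ^ v.asIdeal.inertiaDeg ℤ) •
                    doubleCosetOp k (recordHyperspecial K v l H) (g 0))) := by
  haveI := T5CMFieldCyclicGaloisCriterion.isCyclic_gal K h6
  haveI : v.asIdeal.LiesOver (Ideal.span {(p : ℤ)}) := Ideal.LiesOver.tower_bot P v.asIdeal _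
  refine ⟨T5CMFieldCyclicGaloisCriterion.exists_map_eq_iff_even_inertiaDeg_sextic K h6 p P v he,
    T5CMFieldCyclicGaloisCriterion.ncard_primesOver_eq_one_iff_inertiaDeg_eq_two_or_six K h6 p P v he,
    T5CMFieldCyclicGaloisCriterion.ncard_primesOver_eq_two_iff_odd_inertiaDeg K p P v he, ?_⟩
  intro heven r l k _ _ hl H hH hdet hbad
  exact T5SexticRecordSatake.exists_cells_ncard_and_three_term_record_sextic K h6 p v P he heven l k hl hH hdet
    hbad

end Summit.Ventures.HodgeRepro2.T5SexticGaloisCMSummary
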